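import Literature.AlgebraicGeometry.Modules.UnitCocyclePresented
import HarnessLib

/-!
# A Čech class pulled back from the base and trivial along a section is trivial

Layer `Literature/AlgebraicGeometry/Modules`, namespace `Literature.AlgebraicGeometry.Modules`.
Generic Čech bookkeeping for a morphism of schemes `π : X ⟶ T` WITH A SECTION `ε : T ⟶ X` (`ε ≫ π = 𝟙`), in the
currency of `Modules/UnitCocyclePresented` (classes «presented along `π` by a datum `(A, G)` on `T`»):

* `UnitCocycle.exists_presented_id` — a datum `(A, G)` on `T` satisfying the cocycle identity on the nose presents a
  cocycle on `T` itself (along `𝟙 T`), for any index assignment `idx : T → S` with `t ∈ A (idx t)`;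
* `UnitCocycle.exists_presented_of_hom` — and a cocycle on `X` along `π` (index `idx ∘ π`);
* `CechPic.mk_presented_eq_pullback` — the class presented along `π` is `π^*` of the class presented along `𝟙 T`
  (`CechPic.pullback_mk_presented`);
* `CechPic.mk_presented_eq_one_of_section` — if moreover `ε^*` of the class presented along `π` is trivial, the class
  is trivial: `ε^*` of it is the class presented along `ε ≫ π = 𝟙 T` by the same datum, i.e. the base class (index
  transport along `π (ε t) = t`), which is therefore `1`, and `π^* 1 = 1`.

This is how [MumfordAV1970, §13 p. 125] and [GortzWedhorn2023, Thm. 24.66 with Lemma 24.67] conclude («`𝓛 ≅ pr_T^*𝓜` and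
`𝓜 ≅ σ^*𝓛` is trivial»), at the level of `Ȟ¹(–, 𝒪^×)` and for an ARBITRARY (possibly non-reduced) base `T` — the
divisor-free counterpart of `CartierDivisor.linEquiv_zero_of_isLocallyTrivialOver` (`Motives/CartierDivisorPullbackFromBase`).
Everything is proved; no definitions, no named facts.

## References
* [Hartshorne1977] R. Hartshorne, *Algebraic Geometry*, GTM 52 (1977), III §4 and Ex. III.4.4–4.5, II Ex. 6.8.
* [GortzWedhorn2023] U. Görtz, T. Wedhorn, *Algebraic Geometry II: Cohomology of Schemes* (2023), Lemma 24.67 and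
  Thm. 24.66 (pp. 405–408).
* [MumfordAV1970] D. Mumford, *Abelian Varieties* (1970), §5 Cor. 6 (p. 54), §13 (p. 125).
-/

noncomputable section

open CategoryTheory AlgebraicGeometry Opposite TopologicalSpace

namespace Literature.AlgebraicGeometry.Modules

universe u v

variable {X T : Scheme.{u}} (π : X ⟶ T) {S : Type v} (idx : T → S) (A : S → T.Opens)
  (G : ∀ a b : S, Γ(T, A a ⊓ A b))

namespace UnitCocycle

/-- The cocycle identity of a datum ON THE NOSE implies it modulo `ker ι^♯` for every `ι`.
[cite: Hartshorne1977, III §4 (Čech complex) and Ex. III.4.4] -/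
theorem presentedMul_of_mul {Y : Scheme.{u}} (ι : Y ⟶ T)
    (hmul : ∀ (a b c : S) (i₁ : A a ⊓ A b ⊓ A c ≤ A a ⊓ A b) (i₂ : A a ⊓ A b ⊓ A c ≤ A b ⊓ A c)
      (i₃ : A a ⊓ A b ⊓ A c ≤ A a ⊓ A c), secRes T i₁ (G a b) * secRes T i₂ (G b c) = secRes T i₃ (G a c))
    (a b c : S) (i₁ : A a ⊓ A b ⊓ A c ≤ A a ⊓ A b) (i₂ : A a ⊓ A b ⊓ A c ≤ A b ⊓ A c)
    (i₃ : A a ⊓ A b ⊓ A c ≤ A a ⊓ A c) :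
    ι.app _ (secRes T i₁ (G a b) * secRes T i₂ (G b c)) = ι.app _ (secRes T i₃ (G a c)) :=
  congrArg (ι.app _) (hmul a b c i₁ i₂ i₃)

/-- **A datum with the cocycle identity on the nose presents a cocycle on `T` itself** (along `𝟙 T`), for any
index assignment `idx` with `t ∈ A (idx t)`. [cite: Hartshorne1977, III §4 (Čech complex) and Ex. III.4.4] -/
theorem exists_presented_id (mem : ∀ t, t ∈ A (idx t))
    (hmul : ∀ (a b c : S) (i₁ : A a ⊓ A b ⊓ A c ≤ A a ⊓ A b) (i₂ : A a ⊓ A b ⊓ A c ≤ A b ⊓ A c)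
      (i₃ : A a ⊓ A b ⊓ A c ≤ A a ⊓ A c), secRes T i₁ (G a b) * secRes T i₂ (G b c) = secRes T i₃ (G a c))
    (hunit : ∀ a : S, IsUnit (G a a)) :
    ∃ (g : UnitCocycle T) (hU : ∀ t, g.U t = (𝟙 T) ⁻¹ᵁ A (idx t)),
      ∀ (t t' : T) (V : T.Opens) (ht : V ≤ g.U t) (ht' : V ≤ g.U t'),
        g.g t t' V ht ht' = (𝟙 T : T ⟶ T).appLE (A (idx t) ⊓ A (idx t')) V
          (le_preimage_inf (𝟙 T) (ht.trans_eq (hU t)) (ht'.trans_eq (hU t'))) (G (idx t) (idx t')) :=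
  exists_presented (𝟙 T) idx A G (fun t => mem t) (presentedMul_of_mul A G (𝟙 T) hmul)
    (fun a => (hunit a).map ((𝟙 T : T ⟶ T).app _).hom)

/-- **… and a cocycle on `X` along any `π : X ⟶ T`** (index `idx ∘ π`). [cite: Hartshorne1977, III §4 and Ex. III.4.4] -/
theorem exists_presented_of_hom (mem : ∀ t, t ∈ A (idx t))
    (hmul : ∀ (a b c : S) (i₁ : A a ⊓ A b ⊓ A c ≤ A a ⊓ A b) (i₂ : A a ⊓ A b ⊓ A c ≤ A b ⊓ A c)
      (i₃ : A a ⊓ A b ⊓ A c ≤ A a ⊓ A c), secRes T i₁ (G a b) * secRes T i₂ (G b c) = secRes T i₃ (G a c))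
    (hunit : ∀ a : S, IsUnit (G a a)) :
    ∃ (g : UnitCocycle X) (hU : ∀ x, g.U x = π ⁻¹ᵁ A (idx (π.base x))),
      ∀ (x x' : X) (V : X.Opens) (hx : V ≤ g.U x) (hx' : V ≤ g.U x'),
        g.g x x' V hx hx' = π.appLE (A (idx (π.base x)) ⊓ A (idx (π.base x'))) V
          (le_preimage_inf π (hx.trans_eq (hU x)) (hx'.trans_eq (hU x'))) (G (idx (π.base x)) (idx (π.base x'))) :=
  exists_presented π (fun x => idx (π.base x)) A G (fun x => mem (π.base x)) (presentedMul_of_mul A G π hmul)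
    (fun a => (hunit a).map (π.app _).hom)

end UnitCocycle

namespace CechPic

variable {π idx A G}

/-- **The class presented along `π` is `π^*` of the class presented along `𝟙 T` by the same datum**
(★ `pullback_mk_presented` at `t := π`, `ι′ := 𝟙 T`). [cite: Hartshorne1977, II Ex. 6.8 and III Ex. 4.5] -/
theorem mk_presented_eq_pullback (mem : ∀ t, t ∈ A (idx t))
    {gT : UnitCocycle T} (hUT : ∀ t, gT.U t = (𝟙 T) ⁻¹ᵁ A (idx t))
    (hgT : ∀ (t t' : T) (V : T.Opens) (ht : V ≤ gT.U t) (ht' : V ≤ gT.U t'),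
      gT.g t t' V ht ht' = (𝟙 T : T ⟶ T).appLE (A (idx t) ⊓ A (idx t')) V
        (UnitCocycle.le_preimage_inf (𝟙 T) (ht.trans_eq (hUT t)) (ht'.trans_eq (hUT t'))) (G (idx t) (idx t')))
    {gX : UnitCocycle X} (hUX : ∀ x, gX.U x = π ⁻¹ᵁ A (idx (π.base x)))
    (hgX : ∀ (x x' : X) (V : X.Opens) (hx : V ≤ gX.U x) (hx' : V ≤ gX.U x'),
      gX.g x x' V hx hx' = π.appLE (A (idx (π.base x)) ⊓ A (idx (π.base x'))) V
        (UnitCocycle.le_preimage_inf π (hx.trans_eq (hUX x)) (hx'.trans_eq (hUX x'))) (G (idx (π.base x)) (idx (π.base x')))) :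
    CechPic.pullback π (CechPic.mk gT) = CechPic.mk gX :=
  CechPic.pullback_mk_presented (ι := π) (π := fun x => idx (π.base x)) (A := A) (G := G) π (𝟙 T)
    (Category.comp_id π).symm idx (fun _ => rfl) (fun x => mem (π.base x)) hUX hgX hUT hgT

/-- `π (ε t) = t` for a section `ε` of `π`. [folklore] -/
private theorem base_section_apply (ε : T ⟶ X) (hε : ε ≫ π = 𝟙 T) (t : T) : π.base (ε.base t) = t := by
  have h := congrArg (fun φ : T ⟶ T => φ.base t) hε
  simpa using h

/-- **A class presented along `π` whose pull-back along a SECTION `ε` of `π` is trivial is trivial.**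
`ε^*` of it is the class presented along `ε ≫ π = 𝟙 T` by the same datum (★ `pullback_mk_presented` at `t := ε`),
i.e. the base class (index transport along `π (ε t) = t`, ★ `appLE_congr_index`); so the base class is `1` and the
class is `π^* 1 = 1`. [cite: GortzWedhorn2023, Lemma 24.67 (p. 406) and Thm. 24.66 (conclusion, p. 406)] [cite: MumfordAV1970, §13 (p. 125)] -/
theorem mk_presented_eq_one_of_section (ε : T ⟶ X) (hε : ε ≫ π = 𝟙 T) (mem : ∀ t, t ∈ A (idx t))
    (hmul : ∀ (a b c : S) (i₁ : A a ⊓ A b ⊓ A c ≤ A a ⊓ A b) (i₂ : A a ⊓ A b ⊓ A c ≤ A b ⊓ A c)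
      (i₃ : A a ⊓ A b ⊓ A c ≤ A a ⊓ A c), secRes T i₁ (G a b) * secRes T i₂ (G b c) = secRes T i₃ (G a c))
    (hunit : ∀ a : S, IsUnit (G a a))
    {gX : UnitCocycle X} (hUX : ∀ x, gX.U x = π ⁻¹ᵁ A (idx (π.base x)))
    (hgX : ∀ (x x' : X) (V : X.Opens) (hx : V ≤ gX.U x) (hx' : V ≤ gX.U x'),
      gX.g x x' V hx hx' = π.appLE (A (idx (π.base x)) ⊓ A (idx (π.base x'))) V
        (UnitCocycle.le_preimage_inf π (hx.trans_eq (hUX x)) (hx'.trans_eq (hUX x'))) (G (idx (π.base x)) (idx (π.base x'))))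
    (hεc : CechPic.pullback ε (CechPic.mk gX) = 1) : CechPic.mk gX = 1 := by
  -- the base class, with index `idx`
  obtain ⟨gT, hUT, hgT⟩ := UnitCocycle.exists_presented_id idx A G mem hmul hunit
  have h1 : CechPic.pullback π (CechPic.mk gT) = CechPic.mk gX := mk_presented_eq_pullback mem hUT hgT hUX hgX
  -- the base class, with the transported index `idx (π (ε t))`
  have key : ∀ t, π.base (ε.base t) = t := base_section_apply ε hε
  obtain ⟨gT', hUT', hgT'⟩ := UnitCocycle.exists_presented (𝟙 T) (fun t => idx (π.base (ε.base t))) A G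
    (fun t => by rw [key]; exact mem t) (UnitCocycle.presentedMul_of_mul A G (𝟙 T) hmul)
    (fun a => (hunit a).map ((𝟙 T : T ⟶ T).app _).hom)
  -- `ε^*` of the `X`-class is the transported base class
  have h2 : CechPic.pullback ε (CechPic.mk gX) = CechPic.mk gT' :=
    CechPic.pullback_mk_presented (ι := 𝟙 T) (π := fun t => idx (π.base (ε.base t))) (A := A) (G := G) ε π
      (by rw [hε]) (fun x => idx (π.base x)) (fun _ => rfl) (fun t => by rw [key]; exact mem t) hUT' hgT' hUX hgX
  -- the two base classes agree (same datum, indices equal along `key`)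
  have h3 : CechPic.mk gT' = CechPic.mk gT := by
    refine CechPic.mk_eq_mk_of_presented (ι := 𝟙 T) (π := idx) (A := A) (G := G) (fun t => mem t) hUT hgT
      (fun t => ?_) (fun t t' => ?_)
    · rw [hUT', key]
    · rw [hgT', Scheme.Hom.app_eq_appLE]
      exact appLE_congr_index (𝟙 T) A G (congrArg idx (key t)) (congrArg idx (key t')) _ _
  -- conclude
  have h4 : CechPic.mk gT = 1 := h3.symm.trans (h2.symm.trans hεc)
  rw [← h1, h4, map_one]

end CechPic

end Literature.AlgebraicGeometry.Modules

end
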